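import Summits.ResolutionOfSingularities.ResolutionOfSingularities.Theorems.HilbertSamuelEliminationSigmaMaxModificationsCorridor3WLadderIsoTailsFormalFrameTower
import Mathlib.RingTheory.Localization.AtPrime.Basic
import HarnessLib

/-!
# [OURS · L1 W4.2 · D14 «K1 FREE-RATIONAL TAILS»] G1a-2, part 1/2: POINT MATCHING in the affine blow-up algebra and ONE STEP of
# the frame tower (self-contained 4-ary twin of res-type-038's `…IsoTailsFormalFramePoint` p527358, whose module the farm could not
# serve — «unbuilt / no-olean» 11:35Z–12:05Z — so this file does NOT import it; either may be cited) (crux `SigmaMaxModifications` stmt-ResolutionOfSingularities-18506 / conjunct stmt-…-19249; kernel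
# `IsoQuadraticTowerTerminates p 3`, card C5 K1; res-L1-w42-plan-1 RULING v3.14-14 (DN): «001 := G1a-2 TOWER ASSEMBLY»)

Prover res-type-001 (gen 8) on res-L1-w42-lead-1's CUT G1a (2026-08-27T10:43:09Z), piece (G1a-2). Helper file
`--supports stmt-ResolutionOfSingularities-19249 --as helper`; kernel only, no definitions, no named fact. OURS (cell res-hironaka,
slot W4.2); NOT statements of [Hironaka2017] nor of [CossartJannsenSaito2020] / [CossartPiltant2009]. AI-written; AI review is
weaker than expert review.

## The object

One free-rational step of the embedded chart tower (res-type-071's H4/H5, `…IsoTailsFreeRational.exists_origin_presentation`), read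
ring-theoretically: `(R, 𝔪)` local with generators `x = (t, x₁, x₂, x₃)` of `𝔪` (`t = x 0`), lifts `ã_i ∈ R`, the affine blow-up algebra
`B = R[𝔪/t]` (tree `blowupAlgebra (maximalIdeal R) t`) and a localisation `R′` of `B` at a prime `𝔑` such that the NEW coordinates
`x′ = (t, x₁/t − ã₁, x₂/t − ã₂, x₃/t − ã₃)` generate `𝔪_{R′}` (the point is the κ-rational point `y_i = ã_i t` of the `t`-chart,
071's `origin_rsop`). Given a FORMAL FRAME `ψ : R → κ⟦X₀, …, X₃⟧` of lead-1's `…IsoTailsFormalFrameStep` (local, `ψ t = X 0`,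
residue-surjective, `ψ x_i ≡ X i + λ_i X 0 (mod 𝔪²)`), this file proves:

* §1 `exists_sub_algebraMap_mem_pointIdeal`, `pointIdeal_isMaximal_of_ne_top` — the ideal `𝔑₀ = (t, x_i/t − ã_i)_i ⊆ B` satisfies
  `B = R + 𝔑₀` (adjoin induction on the generators `x/t`, `x = a₀ t + Σ a_i x_i`), hence is MAXIMAL as soon as it is proper
  (038's `exists_sub_algebraMap_mem_of_gens_mem` / `isMaximal_of_gens_mem` are the `d`-ary versions of the same statements);
* §2 `stepPrime_eq_of_le` — consequently ANY proper ideal of `B` containing `t` and the `x_i/t − ã_i` equals lead-1's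
  `FormalFrame.stepPrime c hψt` for the matching constants `c_i = res(ψ ã_i) − λ_i` (both contain `𝔑₀`: `span_le_stepPrime`,
  `t_mem_stepPrime`), in particular the prime `𝔑` of the tower (`prime_eq_stepPrime_of_tower`: membership of `t`, `x_i/t − ã_i` in
  `𝔑` is read off in `R′` from `x′_i · t = x_i − ã_i t`, `t` a non-zero-divisor of `R′`);
* §3 **`exists_stepFrame_of_tower`** — ONE STEP: there are a frame `ψ′ : R′ → κ⟦X⟧` and constants `c` with
  `ψ′ ∘ (R → R′) = (y ↦ t y + c t) ∘ ψ` (`stepFrame_algebraMap_algebraMap`), `ψ′` local (`isLocalHom_stepFrame`), `ψ′ t = X 0`,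
  residue-surjective, and `ψ′ x′_i ≡ X i + λ′_i X 0 (mod 𝔪²)` (`stepLift_newCoord_sub_mem_span` + `exists_sub_C_mul_X_zero_mem_sq`)
  — the invariant propagates, so the construction iterates (part 2/2, `…IsoTailsFormalFrameAssembly`: the ℕ-recursion).

References: U. Görtz, T. Wedhorn, *Algebraic Geometry I* (2nd ed. 2020), (13.19) p. 415 [GortzWedhorn2020]; V. Cossart, O. Piltant,
J. Algebra 320 (2008), proof of Lemma 4.3 (3) (the origin of the shifted chart) [CossartPiltant2008]; idea-1 card C5.
-/

noncomputable section

set_option linter.dupNamespace false -- mandated namespace of this single-conjunct summit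

open MvPowerSeries IsLocalRing
open Literature.AlgebraicGeometry.Resolution

namespace Summit.ResolutionOfSingularities.ResolutionOfSingularities.Cruxes.SigmaMaxModifications.IdeasL1C5

universe u

namespace FormalFrame

/-! ### §1. The point ideal `𝔑₀ = (t, x_i/t − ã_i)` of `R[𝔪/t]` is maximal -/

section PointIdeal

variable {R : Type u} [CommRing R] [IsLocalRing R]

/-- Each generator `x_i` lies in `𝔪`. [folklore] -/
theorem mem_maximalIdeal_of_span (x : Fin 4 → R) (hx : Ideal.span (Set.range x) = maximalIdeal R) (i : Fin 4) :
    x i ∈ maximalIdeal R :=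
  hx ▸ Ideal.subset_span ⟨i, rfl⟩

/-- The generator `x_i/t` of `R[𝔪/t]` (`t = x 0`). [folklore] -/
theorem coordDiv_mem (x : Fin 4 → R) (hx : Ideal.span (Set.range x) = maximalIdeal R) (i : Fin 4) :
    algebraMap R (Localization.Away (x 0)) (x i) * IsLocalization.Away.invSelf (x 0) ∈ blowupAlgebra (maximalIdeal R) (x 0) :=
  div_mem_blowupAlgebra (maximalIdeal R) (x 0) (mem_maximalIdeal_of_span x hx i)

/-- `x_0/t = 1` (`t = x 0`). [folklore] -/
theorem coordDiv_self_eq_one (x : Fin 4 → R) (hx : Ideal.span (Set.range x) = maximalIdeal R) :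
    (⟨_, coordDiv_mem x hx 0⟩ : blowupAlgebra (maximalIdeal R) (x 0)) = 1 :=
  Subtype.ext (IsLocalization.Away.mul_invSelf (x 0))

/-- `(x_i/t) · t = x_i` in `R[𝔪/t]`. [folklore] -/
theorem coordDiv_mul_t (x : Fin 4 → R) (hx : Ideal.span (Set.range x) = maximalIdeal R) (i : Fin 4) :
    (⟨_, coordDiv_mem x hx i⟩ : blowupAlgebra (maximalIdeal R) (x 0)) * algebraMap R _ (x 0) = algebraMap R _ (x i) :=
  Subtype.ext (div_mul_algebraMap (x 0) (x i))

/-- Subtraction of an `R`-element from an element of `R[𝔪/t]` given by its value in `R[1/t]`. [folklore] -/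
theorem mk_sub_algebraMap (x : Fin 4 → R) {y : Localization.Away (x 0)} (hy : y ∈ blowupAlgebra (maximalIdeal R) (x 0)) (r : R) :
    ((⟨y, hy⟩ : blowupAlgebra (maximalIdeal R) (x 0)) - algebraMap R _ r : blowupAlgebra (maximalIdeal R) (x 0)) =
      ⟨y - algebraMap R (Localization.Away (x 0)) r, Subalgebra.sub_mem _ hy (Subalgebra.algebraMap_mem _ r)⟩ :=
  Subtype.ext rfl

/-- **`B = R + 𝔑₀`**: every element of `R[𝔪/t]` is congruent to an element of `R` modulo any ideal `N` containing the new
coordinates `x_i/t − ã_i` (`i = 1, 2, 3`). Adjoin induction: a generator `x/t`, `x = Σ a_i x_i ∈ 𝔪`, is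
`a₀ + Σ_{i ≥ 1} a_i (x_i/t) ≡ a₀ + Σ_{i ≥ 1} a_i ã_i`. [cite: GortzWedhorn2020, (13.19) p. 415] -/
theorem exists_sub_algebraMap_mem_pointIdeal (x : Fin 4 → R) (hx : Ideal.span (Set.range x) = maximalIdeal R) (at_ : Fin 4 → R)
    (N : Ideal (blowupAlgebra (maximalIdeal R) (x 0)))
    (hN : ∀ i, i ≠ 0 → (⟨_, coordDiv_mem x hx i⟩ - algebraMap R _ (at_ i) : blowupAlgebra (maximalIdeal R) (x 0)) ∈ N)
    (b : blowupAlgebra (maximalIdeal R) (x 0)) : ∃ r : R, b - algebraMap R _ r ∈ N := by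
  obtain ⟨y, hy⟩ := b
  refine Algebra.adjoin_induction (hx := hy) ?_ ?_ ?_ ?_
  · rintro _ ⟨z, hz, rfl⟩
    -- `z = Σ a_i x_i`
    have hz' : z ∈ Ideal.span (Set.range x) := hx ▸ hz
    obtain ⟨a, ha⟩ := Ideal.mem_span_range_iff_exists_fun.mp hz'
    refine ⟨a 0 + ∑ j : Fin 3, a j.succ * at_ j.succ, ?_⟩
    -- `z/t = Σ a_i (x_i/t)` in `R[𝔪/t]`
    have hsum : (⟨_, div_mem_blowupAlgebra (maximalIdeal R) (x 0) hz⟩ : blowupAlgebra (maximalIdeal R) (x 0)) =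
        ∑ i, algebraMap R _ (a i) * ⟨_, coordDiv_mem x hx i⟩ := by
      apply Subtype.ext
      simp only [AddSubmonoidClass.coe_finsetSum, Subalgebra.coe_mul, Subalgebra.coe_algebraMap]
      rw [← ha, map_sum, Finset.sum_mul]
      refine Finset.sum_congr rfl fun i _ => ?_
      rw [map_mul, mul_assoc]
    have hkey : (⟨_, div_mem_blowupAlgebra (maximalIdeal R) (x 0) hz⟩ : blowupAlgebra (maximalIdeal R) (x 0)) -
        algebraMap R _ (a 0 + ∑ j : Fin 3, a j.succ * at_ j.succ) =
        ∑ j : Fin 3, algebraMap R _ (a j.succ) * (⟨_, coordDiv_mem x hx j.succ⟩ - algebraMap R _ (at_ j.succ)) := by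
      rw [hsum, Fin.sum_univ_succ, coordDiv_self_eq_one x hx, mul_one, map_add, map_sum]
      simp only [map_mul, mul_sub, Finset.sum_sub_distrib]
      ring
    rw [hkey]
    exact Ideal.sum_mem _ fun j _ => Ideal.mul_mem_left _ _ (hN j.succ (Fin.succ_ne_zero j))
  · intro r
    refine ⟨r, ?_⟩
    rw [mk_sub_algebraMap x]
    have : (⟨algebraMap R (Localization.Away (x 0)) r - algebraMap R (Localization.Away (x 0)) r,
        Subalgebra.sub_mem _ (Subalgebra.algebraMap_mem _ r) (Subalgebra.algebraMap_mem _ r)⟩ :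
        blowupAlgebra (maximalIdeal R) (x 0)) = 0 := Subtype.ext (sub_self _)
    rw [this]
    exact zero_mem _
  · intro y₁ y₂ hy₁ hy₂ h₁ h₂
    obtain ⟨r₁, h₁⟩ := h₁
    obtain ⟨r₂, h₂⟩ := h₂
    refine ⟨r₁ + r₂, ?_⟩
    have hadd : (⟨y₁ + y₂, Subalgebra.add_mem _ hy₁ hy₂⟩ : blowupAlgebra (maximalIdeal R) (x 0)) = ⟨y₁, hy₁⟩ + ⟨y₂, hy₂⟩ := rfl
    have : (⟨y₁ + y₂, Subalgebra.add_mem _ hy₁ hy₂⟩ : blowupAlgebra (maximalIdeal R) (x 0)) - algebraMap R _ (r₁ + r₂) =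
        (⟨y₁, hy₁⟩ - algebraMap R _ r₁) + (⟨y₂, hy₂⟩ - algebraMap R _ r₂) := by
      rw [hadd, map_add]; ring
    rw [this]
    exact Ideal.add_mem _ h₁ h₂
  · intro y₁ y₂ hy₁ hy₂ h₁ h₂
    obtain ⟨r₁, h₁⟩ := h₁
    obtain ⟨r₂, h₂⟩ := h₂
    refine ⟨r₁ * r₂, ?_⟩
    have hmul : (⟨y₁ * y₂, Subalgebra.mul_mem _ hy₁ hy₂⟩ : blowupAlgebra (maximalIdeal R) (x 0)) = ⟨y₁, hy₁⟩ * ⟨y₂, hy₂⟩ := rfl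
    have : (⟨y₁ * y₂, Subalgebra.mul_mem _ hy₁ hy₂⟩ : blowupAlgebra (maximalIdeal R) (x 0)) - algebraMap R _ (r₁ * r₂) =
        (⟨y₁, hy₁⟩ - algebraMap R _ r₁) * ⟨y₂, hy₂⟩ + algebraMap R _ r₁ * (⟨y₂, hy₂⟩ - algebraMap R _ r₂) := by
      rw [hmul, map_mul]; ring
    rw [this]
    exact Ideal.add_mem _ (Ideal.mul_mem_right _ _ h₁) (Ideal.mul_mem_left _ _ h₂)

/-- **The point ideal is maximal.** Any PROPER ideal `N` of `R[𝔪/t]` containing `t` and the new coordinates `x_i/t − ã_i`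
(`i = 1, 2, 3`) is maximal: `R ↠ R[𝔪/t]/N` (previous lemma) with kernel `⊇ 𝔪` (it contains `t` and `x_i = (x_i/t)·t`), so
`R[𝔪/t]/N` is a quotient of the residue field. [cite: GortzWedhorn2020, (13.19) p. 415] -/
theorem pointIdeal_isMaximal_of_ne_top (x : Fin 4 → R) (hx : Ideal.span (Set.range x) = maximalIdeal R) (at_ : Fin 4 → R)
    (N : Ideal (blowupAlgebra (maximalIdeal R) (x 0))) (hNtop : N ≠ ⊤) (hNt : algebraMap R _ (x 0) ∈ N)
    (hN : ∀ i, i ≠ 0 → (⟨_, coordDiv_mem x hx i⟩ - algebraMap R _ (at_ i) : blowupAlgebra (maximalIdeal R) (x 0)) ∈ N) :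
    N.IsMaximal := by
  let φ : R →+* blowupAlgebra (maximalIdeal R) (x 0) ⧸ N := (Ideal.Quotient.mk N).comp (algebraMap R _)
  have hφ : Function.Surjective φ := by
    intro q
    obtain ⟨b, rfl⟩ := Ideal.Quotient.mk_surjective q
    obtain ⟨r, hr⟩ := exists_sub_algebraMap_mem_pointIdeal x hx at_ N hN b
    refine ⟨r, ?_⟩
    change Ideal.Quotient.mk N (algebraMap R _ r) = Ideal.Quotient.mk N b
    rw [Ideal.Quotient.eq]
    have : algebraMap R (blowupAlgebra (maximalIdeal R) (x 0)) r - b = -(b - algebraMap R _ r) := by ring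
    rw [this]
    exact N.neg_mem hr
  haveI : Nontrivial (blowupAlgebra (maximalIdeal R) (x 0) ⧸ N) := Ideal.Quotient.nontrivial_iff.mpr hNtop
  -- `𝔪 ⊆ ker φ`, hence `ker φ = 𝔪`
  have hker : maximalIdeal R ≤ RingHom.ker φ := by
    refine hx.symm.le.trans (Ideal.span_le.mpr ?_)
    rintro _ ⟨i, rfl⟩
    change Ideal.Quotient.mk N (algebraMap R _ (x i)) = 0
    rw [Ideal.Quotient.eq_zero_iff_mem, ← coordDiv_mul_t x hx i]
    exact Ideal.mul_mem_left _ _ hNt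
  have hker' : RingHom.ker φ = maximalIdeal R :=
    ((IsLocalRing.maximalIdeal.isMaximal R).eq_of_le (RingHom.ker_ne_top φ) hker).symm
  -- `B/N ≅ R/𝔪` is a field
  let e : (R ⧸ RingHom.ker φ) ≃+* blowupAlgebra (maximalIdeal R) (x 0) ⧸ N := RingHom.quotientKerEquivOfSurjective hφ
  have h1 : IsField (R ⧸ RingHom.ker φ) := by
    rw [hker', ← Ideal.Quotient.maximal_ideal_iff_isField_quotient]
    exact IsLocalRing.maximalIdeal.isMaximal R
  exact Ideal.Quotient.maximal_of_isField N (MulEquiv.isField h1 e.symm.toMulEquiv)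

end PointIdeal

/-! ### §2. The prime of the tower IS the prime seen by the frame -/

section Matching

variable {κ : Type u} [Field κ] {R : Type u} [CommRing R] [IsLocalRing R]

/-- **Point matching by maximality.** If `ψ x_i ≡ X i + λ_i X 0 (mod 𝔪²)` and `c_i = res(ψ ã_i) − λ_i` (`i ≠ 0`), then every
PROPER ideal `N` of `R[𝔪/t]` containing `t` and the `x_i/t − ã_i` IS lead-1's `stepPrime c hψt` (both contain the maximal point
ideal `𝔑₀`; `span_le_stepPrime`, `t_mem_stepPrime`). [folklore] -/
theorem stepPrime_eq_of_le (x : Fin 4 → R) (hx : Ideal.span (Set.range x) = maximalIdeal R) (at_ : Fin 4 → R)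
    {ψ : R →+* MvPowerSeries (Fin 4) κ} [IsLocalHom ψ] (c : Fin 4 → κ) (hψt : ψ (x 0) = X 0) {lam : Fin 4 → κ}
    (hψr : ∀ i, i ≠ 0 → ψ (x i) - X i - C (lam i) * X 0 ∈ maximalIdeal (MvPowerSeries (Fin 4) κ) ^ 2)
    (hc : ∀ i, i ≠ 0 → c i = constantCoeff (ψ (at_ i)) - lam i)
    (N : Ideal (blowupAlgebra (maximalIdeal R) (x 0))) (hNtop : N ≠ ⊤) (hNt : algebraMap R _ (x 0) ∈ N)
    (hN : ∀ i, i ≠ 0 → (⟨_, coordDiv_mem x hx i⟩ - algebraMap R _ (at_ i) : blowupAlgebra (maximalIdeal R) (x 0)) ∈ N) :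
    N = stepPrime c hψt := by
  -- the point ideal `𝔑₀`
  let N₀ : Ideal (blowupAlgebra (maximalIdeal R) (x 0)) :=
    Ideal.span ({algebraMap R _ (x 0)} ∪ Set.range fun j : Fin 3 =>
      (⟨_, coordDiv_mem x hx j.succ⟩ - algebraMap R _ (at_ j.succ) : blowupAlgebra (maximalIdeal R) (x 0)))
  have hN₀t : algebraMap R _ (x 0) ∈ N₀ := Ideal.subset_span (Set.mem_union_left _ rfl)
  have hN₀r : ∀ i, i ≠ 0 → (⟨_, coordDiv_mem x hx i⟩ - algebraMap R _ (at_ i) : blowupAlgebra (maximalIdeal R) (x 0)) ∈ N₀ := by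
    intro i hi
    obtain ⟨j, rfl⟩ := Fin.exists_succ_eq.mpr hi
    exact Ideal.subset_span (Set.mem_union_right _ ⟨j, rfl⟩)
  -- `𝔑₀ ⊆ N` and `𝔑₀ ⊆ stepPrime`
  have hle : ∀ M : Ideal (blowupAlgebra (maximalIdeal R) (x 0)), algebraMap R _ (x 0) ∈ M →
      (∀ i, i ≠ 0 → (⟨_, coordDiv_mem x hx i⟩ - algebraMap R _ (at_ i) : blowupAlgebra (maximalIdeal R) (x 0)) ∈ M) → N₀ ≤ M := by
    intro M hMt hMr
    rw [Ideal.span_le]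
    rintro _ (rfl | ⟨j, rfl⟩)
    · exact hMt
    · exact hMr j.succ (Fin.succ_ne_zero j)
  have hleN : N₀ ≤ N := hle N hNt hN
  have hleS : N₀ ≤ stepPrime c hψt :=
    hle _ (t_mem_stepPrime c hψt) (span_le_stepPrime c hψt (fun i _ => mem_maximalIdeal_of_span x hx i) hψr at_ hc)
  have hStop : stepPrime c hψt ≠ ⊤ := Ideal.IsPrime.ne_top inferInstance
  have hN₀top : N₀ ≠ ⊤ := fun h => hStop (eq_top_iff.mpr (h ▸ hleS))
  have hmax : N₀.IsMaximal := pointIdeal_isMaximal_of_ne_top x hx at_ N₀ hN₀top hN₀t hN₀r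
  rw [← hmax.eq_of_le hNtop hleN, ← hmax.eq_of_le hStop hleS]

/-- **The new coordinates in `R′`**: `x′_i = (x_i/t − ã_i)/1`, read off from `x′_i · t = x_i − ã_i t` and `t` a non-zero-divisor
of `R′`. [folklore] -/
theorem algebraMap_newCoord_eq (x : Fin 4 → R) (hxm : ∀ i, x i ∈ maximalIdeal R) (at_ : Fin 4 → R)
    (R' : Type u) [CommRing R'] [Algebra R R'] [Algebra (blowupAlgebra (maximalIdeal R) (x 0)) R']
    [IsScalarTower R (blowupAlgebra (maximalIdeal R) (x 0)) R'] (x' : Fin 4 → R') (ht : algebraMap R R' (x 0) = x' 0)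
    (hr : ∀ i, i ≠ 0 → x' i * x' 0 = algebraMap R R' (x i) - algebraMap R R' (at_ i) * x' 0)
    (hnz : x' 0 ∈ nonZeroDivisors R') (i : Fin 4) (hi : i ≠ 0) :
    algebraMap (blowupAlgebra (maximalIdeal R) (x 0)) R'
        (⟨_, div_mem_blowupAlgebra (maximalIdeal R) (x 0) (hxm i)⟩ - algebraMap R _ (at_ i)) = x' i := by
  apply (mul_cancel_right_mem_nonZeroDivisors hnz).mp
  have hdiv : (⟨_, div_mem_blowupAlgebra (maximalIdeal R) (x 0) (hxm i)⟩ : blowupAlgebra (maximalIdeal R) (x 0)) *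
      algebraMap R _ (x 0) = algebraMap R _ (x i) :=
    Subtype.ext (div_mul_algebraMap (x 0) (x i))
  have key : ((⟨_, div_mem_blowupAlgebra (maximalIdeal R) (x 0) (hxm i)⟩ : blowupAlgebra (maximalIdeal R) (x 0)) -
      algebraMap R _ (at_ i)) * algebraMap R _ (x 0) = algebraMap R _ (x i) - algebraMap R _ (at_ i) * algebraMap R _ (x 0) := by
    rw [sub_mul, hdiv]
  have h2 := congrArg (algebraMap (blowupAlgebra (maximalIdeal R) (x 0)) R') key
  simp only [map_mul, map_sub, ← IsScalarTower.algebraMap_apply, ht] at h2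
  rw [hr i hi, map_sub, ← IsScalarTower.algebraMap_apply]
  exact h2

/-- **The prime of the tower is the prime seen by the frame**: `𝔑 = stepPrime c hψt` for the matching constants, for ANY prime `𝔑`
of `R[𝔪/t]` at which `R′` is the localisation, when the new coordinates `x′` generate `𝔪_{R′}` — the memberships `t ∈ 𝔑`,
`x_i/t − ã_i ∈ 𝔑` are read in `R′` (`t = x′_0` and `x′_i` are non-units). [folklore] -/
theorem prime_eq_stepPrime_of_tower (x : Fin 4 → R) (hx : Ideal.span (Set.range x) = maximalIdeal R) (at_ : Fin 4 → R)
    {ψ : R →+* MvPowerSeries (Fin 4) κ} [IsLocalHom ψ] (c : Fin 4 → κ) (hψt : ψ (x 0) = X 0) {lam : Fin 4 → κ}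
    (hψr : ∀ i, i ≠ 0 → ψ (x i) - X i - C (lam i) * X 0 ∈ maximalIdeal (MvPowerSeries (Fin 4) κ) ^ 2)
    (hc : ∀ i, i ≠ 0 → c i = constantCoeff (ψ (at_ i)) - lam i)
    (R' : Type u) [CommRing R'] [IsLocalRing R'] [Algebra R R'] [Algebra (blowupAlgebra (maximalIdeal R) (x 0)) R']
    [IsScalarTower R (blowupAlgebra (maximalIdeal R) (x 0)) R']
    (𝔑 : Ideal (blowupAlgebra (maximalIdeal R) (x 0))) [𝔑.IsPrime] [IsLocalization.AtPrime R' 𝔑]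
    (x' : Fin 4 → R') (hx' : Ideal.span (Set.range x') = maximalIdeal R') (ht : algebraMap R R' (x 0) = x' 0)
    (hr : ∀ i, i ≠ 0 → x' i * x' 0 = algebraMap R R' (x i) - algebraMap R R' (at_ i) * x' 0)
    (hnz : x' 0 ∈ nonZeroDivisors R') :
    𝔑 = stepPrime c hψt := by
  have hx'm : ∀ i, x' i ∈ maximalIdeal R' := fun i => hx' ▸ Ideal.subset_span ⟨i, rfl⟩
  have hmem : ∀ b : blowupAlgebra (maximalIdeal R) (x 0), algebraMap _ R' b ∈ maximalIdeal R' → b ∈ 𝔑 := fun b hb =>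
    (IsLocalization.AtPrime.to_map_mem_maximal_iff R' 𝔑 b).mp hb
  refine stepPrime_eq_of_le x hx at_ c hψt hψr hc 𝔑 (Ideal.IsPrime.ne_top inferInstance) ?_ ?_
  · apply hmem
    rw [← IsScalarTower.algebraMap_apply, ht]
    exact hx'm 0
  · intro i hi
    apply hmem
    rw [algebraMap_newCoord_eq x (mem_maximalIdeal_of_span x hx) at_ R' x' ht hr hnz i hi]
    exact hx'm i

end Matching

/-! ### §3. One step of the frame tower -/

section OneStep

variable {κ : Type u} [Field κ] {R : Type u} [CommRing R] [IsLocalRing R]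

/-- **ONE STEP OF THE FRAME TOWER.** Data: generators `x = (t, x₁, x₂, x₃)` of `𝔪_R`, lifts `ã`, a local frame `ψ : R → κ⟦X⟧`
with `ψ t = X 0`, residue surjectivity and the coordinate invariant `ψ x_i ≡ X i + λ_i X 0 (mod 𝔪²)`; the next ring `R′`, a
localisation of `R[𝔪/t]` at a prime, an `R`-algebra through `R[𝔪/t]`, whose maximal ideal is generated by `x′ = (t, x_i/t − ã_i)`
(`x′_i · t = x_i − ã_i t`, `t` a non-zero-divisor of `R′`). Conclusion: a local frame `ψ′ : R′ → κ⟦X⟧` with `ψ′ t = X 0`, residue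
surjectivity, the coordinate invariant for `x′` (new slopes `λ′`), and THE COMMUTATION `ψ′ ∘ (R → R′) = (y ↦ t y + c t) ∘ ψ` for the
matching constants `c_i = res(ψ ã_i) − λ_i` — i.e. the hypotheses of lead-1's `FormalFrame.mem_pow_of_frameTower` propagate one
step (`ψ′ = stepFrame c hψt R′` on `𝔑 = stepPrime c hψt`). [OURS · L1 W4.2; AI-written] [cite: GortzWedhorn2020, (13.19) p. 415] -/
theorem exists_stepFrame_of_tower (x : Fin 4 → R) (hx : Ideal.span (Set.range x) = maximalIdeal R) (at_ : Fin 4 → R)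
    (ψ : R →+* MvPowerSeries (Fin 4) κ) (hψl : IsLocalHom ψ) (hψt : ψ (x 0) = X 0)
    (hψs : ∀ a : κ, ∃ r : R, ψ r - C a ∈ maximalIdeal (MvPowerSeries (Fin 4) κ))
    (hψr : ∃ lam : Fin 4 → κ, ∀ i, i ≠ 0 → ψ (x i) - X i - C (lam i) * X 0 ∈ maximalIdeal (MvPowerSeries (Fin 4) κ) ^ 2)
    (R' : Type u) [CommRing R'] [IsLocalRing R'] [Algebra R R'] [Algebra (blowupAlgebra (maximalIdeal R) (x 0)) R']
    [IsScalarTower R (blowupAlgebra (maximalIdeal R) (x 0)) R']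
    (𝔑 : Ideal (blowupAlgebra (maximalIdeal R) (x 0))) [𝔑.IsPrime] [IsLocalization.AtPrime R' 𝔑]
    (x' : Fin 4 → R') (hx' : Ideal.span (Set.range x') = maximalIdeal R') (ht : algebraMap R R' (x 0) = x' 0)
    (hr : ∀ i, i ≠ 0 → x' i * x' 0 = algebraMap R R' (x i) - algebraMap R R' (at_ i) * x' 0)
    (hnz : x' 0 ∈ nonZeroDivisors R') :
    ∃ (ψ' : R' →+* MvPowerSeries (Fin 4) κ) (c : Fin 4 → κ),
      IsLocalHom ψ' ∧ ψ' (x' 0) = X 0 ∧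
      (∀ a : κ, ∃ r : R', ψ' r - C a ∈ maximalIdeal (MvPowerSeries (Fin 4) κ)) ∧
      (∃ lam' : Fin 4 → κ, ∀ i, i ≠ 0 →
        ψ' (x' i) - X i - C (lam' i) * X 0 ∈ maximalIdeal (MvPowerSeries (Fin 4) κ) ^ 2) ∧
      ∀ r : R, ψ' (algebraMap R R' r) = subst (Series.transChartSubst c) (ψ r) := by
  haveI := hψl
  obtain ⟨lam, hlam⟩ := hψr
  -- the matching constants
  let c : Fin 4 → κ := fun i => constantCoeff (ψ (at_ i)) - lam i
  have hc : ∀ i, i ≠ 0 → c i = constantCoeff (ψ (at_ i)) - lam i := fun _ _ => rfl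
  -- point matching: `𝔑` is the prime seen by the frame
  have heq : 𝔑 = stepPrime c hψt := prime_eq_stepPrime_of_tower x hx at_ c hψt hlam hc R' 𝔑 x' hx' ht hr hnz
  subst heq
  refine ⟨stepFrame c hψt R', c, isLocalHom_stepFrame c hψt R', ?_, ?_, ?_, stepFrame_algebraMap_algebraMap c hψt R'⟩
  · rw [← ht, stepFrame_t]
  · intro a
    obtain ⟨r, hr'⟩ := hψs a
    refine ⟨algebraMap R R' r, ?_⟩
    rw [stepFrame_algebraMap_algebraMap, ← substHom_apply]
    have hX0 : Ideal.span {(X 0 : MvPowerSeries (Fin 4) κ)} ≤ maximalIdeal _ := by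
      rw [Ideal.span_le, Set.singleton_subset_iff]
      exact (mem_maximalIdeal_iff _).mpr (constantCoeff_X _)
    exact hX0 (substHom_sub_C_mem_span c hr')
  · have hxm := mem_maximalIdeal_of_span x hx
    have hnew : ∀ i, i ≠ 0 → ∃ lam' : κ, stepFrame c hψt R' (x' i) - X i - C lam' * X 0 ∈
        maximalIdeal (MvPowerSeries (Fin 4) κ) ^ 2 := by
      intro i hi
      rw [← algebraMap_newCoord_eq x hxm at_ R' x' ht hr hnz i hi, stepFrame_algebraMap]
      apply exists_sub_C_mul_X_zero_mem_sq
      refine stepLift_newCoord_sub_mem_span c hψt (hxm i) hi (hlam i hi) ?_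
      rw [hc i hi, sub_add_cancel]
      exact sub_C_constantCoeff_mem _
    choose! lam' hlam' using hnew
    exact ⟨lam', hlam'⟩

end OneStep

end FormalFrame

end Summit.ResolutionOfSingularities.ResolutionOfSingularities.Cruxes.SigmaMaxModifications.IdeasL1C5

end
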